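import Summits.ResolutionOfSingularities.ResolutionOfSingularities.Theorems.FrobeniusClosingPatchingRelPerfectDepthOneExceptionalDimension
import HarnessLib

/-!
# Crux `PatchingRelPerfect` (stmt-ResolutionOfSingularities-16161), chain w52 — R4 X-side, graded initial
# state (D): the RETRACTION of `X₁ = Bl_𝔪 Spec S` onto its exceptional divisor over a coefficient field

[OURS · L1 W5.2 · rung tool] res-L1-w52-lead-1 g3 DESIGN 2026-08-27 (D) / res-L1-w52-plan-1 g6 KERNEL NOTE
(the retraction model `K = r^*𝔟 ⊔ 𝓘_E^ℓ` of `Resolution/RetractionBlowupTransform.lean` needs, at the initial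
state, a retraction `r : X₁ → E`; it exists when `S` has a COEFFICIENT FIELD — hand res-D-pv-055).  Setting:
`S` a commutative ring, `y = (y₀, …, y_m)` a quasi-regular sequence generating a MAXIMAL ideal `𝔪`,
`κ₀` a field with `κ₀ → S` such that `κ₀ → S → S/𝔪` is bijective; `X₁ = Bl_𝔪 Spec S` (`affineBlowup`),
`g = affineBlowup.π`, `E = V(𝔪𝒪_{X₁})` with `i = subschemeι`.  PROVED (fact-free, chart-free):

* `r₀ : X₁ ⟶ ℙᵐ_{κ₀}` (written out, no new definition) — the composite of the graded presentation
  `X₁ = Proj S[𝔪t] → ℙᵐ_S` (`T_j ↦ y_j t`, tree `reesPresentation`) with the base change `ℙᵐ_S → ℙᵐ_{κ₀}`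
  (`mapGraded κ₀ S`); chartwise `κ₀[T_j/T_i] → S[𝔪/y_i]`, `T_j/T_i ↦ y_j/y_i` — the line-bundle projection
  `Tot(𝒪_{ℙᵐ}(-1)) → ℙᵐ`;
* `DepthOne.isIso_subschemeι_comp_retraction₀` — **`i ≫ r₀ : E ⟶ ℙᵐ_{κ₀}` is an isomorphism**: `E` is the
  fibre product `X₁ ×_{Spec S} V(𝔪~)` (Mathlib `comapIso`), which is `ℙᵐ_S ×_S V(𝔪~)` (tree
  `isPullback_exceptional_projectiveSpace`, Hartshorne II 8.24 (b)), which is `ℙᵐ_{κ₀} ×_{κ₀} V(𝔪~)`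
  (`isPullback_projMap'` pasted), and `V(𝔪~) ≅ Spec (S/𝔪) ≅ Spec κ₀`;
* `DepthOne.exists_retraction` — **`r := r₀ ≫ inv (i ≫ r₀) : X₁ ⟶ E` with `i ≫ r = 𝟙 E`** and
  `r₀^*𝔟 = r^*((i ≫ r₀)^*𝔟)` for every ideal sheaf `𝔟` of `ℙᵐ_{κ₀}`.

Completeness / perfectness of `S` are NOT used: the coefficient field is a hypothesis (Cohen's structure
theorem is where the core would cash them). Nothing here is a statement of the manuscript under review.

## References

* R. Hartshorne, *Algebraic Geometry* (1977), II Thm. 8.24 (b). [Hartshorne1977]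
* U. Görtz, T. Wedhorn, *Algebraic Geometry I*, 2nd ed. (2020), Def. 13.90, Prop. 13.91, (13.9). [GortzWedhorn2020]
* Q. Liu, *Algebraic Geometry and Arithmetic Curves* (2002), Prop. 3.1.9, Ex. 3.1.10. [Liu2002]
-/

-- `Summit.<Summit>.<Sub>.Theorems` with `Sub = Summit` (single-conjunct summit, D-0017)
set_option linter.dupNamespace false

noncomputable section

open CategoryTheory CategoryTheory.Limits AlgebraicGeometry Literature.AlgebraicGeometry.Resolution
open IsLocalRing TopologicalSpace
open Literature.AlgebraicGeometry.Motives Literature.AlgebraicGeometry.Motives.ProjBaseChangeRing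

namespace Summit.ResolutionOfSingularities.ResolutionOfSingularities.Theorems

namespace DepthOne

universe u

section Retraction

variable {S : Type u} [CommRing S] {m : ℕ} (y : Fin (m + 1) → S)
  (κ₀ : Type u) [Field κ₀] [Algebra κ₀ S]

local notation3 "M" => Ideal.span (Set.range y)
local notation3 "X₁" => affineBlowup (Ideal.span (Set.range y))
local notation3 "g" => affineBlowup.π (Ideal.span (Set.range y))
local notation3 "𝓔" => (affineBlowup.idealSheaf (Ideal.span (Set.range y))).comap
  (affineBlowup.π (Ideal.span (Set.range y)))

/-! `r₀ : X₁ ⟶ ℙᵐ_{κ₀}` is the composite of the graded presentation `X₁ = Proj S[𝔪t] → ℙᵐ_S`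
(`T_j ↦ y_j t`, tree `reesPresentation`) with the base change `ℙᵐ_S → ℙᵐ_{κ₀}` (`mapGraded κ₀ S`); it is
written out in full below (no new definition), under the standard gradings of the polynomial rings
(Mathlib keeps `MvPolynomial.gradedAlgebra` a `def`, whence the `letI`s in the statements). -/

local notation3 "R₀" => (Proj.map (reesPresentation y) (irrelevant_le_map_reesPresentation y) ≫
  Proj.map (mapGraded κ₀ S (Fin (m + 1))) (irrelevant_le_map κ₀ S (Fin (m + 1))) :
    affineBlowup (Ideal.span (Set.range y)) ⟶ ProjSpace.P m κ₀)

/-- The closed subscheme `V(𝔪~) ⊂ Spec S` followed by `Spec S → Spec κ₀` is an isomorphism when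
`κ₀ → S/𝔪` is bijective (`V(𝔪~) ≅ Spec (S/𝔪)`, two closed immersions with the same kernel). [folklore] -/
theorem isIso_subschemeι_comp_specMap_algebraMap
    (hκ : Function.Bijective (algebraMap κ₀ (S ⧸ M))) :
    IsIso ((affineBlowup.idealSheaf (M)).subschemeι ≫ Spec.map (CommRingCat.ofHom (algebraMap κ₀ S))) := by
  -- `σ : V(𝔪~) ⟶ Spec (S/𝔪)` over `Spec S`, an isomorphism
  haveI hj : IsClosedImmersion (Spec.map (CommRingCat.ofHom (Ideal.Quotient.mk (M)))) :=
    IsClosedImmersion.spec_of_surjective _ Ideal.Quotient.mk_surjective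
  have hker : (Spec.map (CommRingCat.ofHom (Ideal.Quotient.mk (M)))).ker =
      (affineBlowup.idealSheaf (M)).subschemeι.ker := by
    rw [ker_specMap_eq_idealSheaf, Ideal.mk_ker, Scheme.IdealSheafData.ker_subschemeι]
  let σ := IsClosedImmersion.lift (Spec.map (CommRingCat.ofHom (Ideal.Quotient.mk (M))))
    (affineBlowup.idealSheaf (M)).subschemeι hker.le
  have hσ : σ ≫ Spec.map (CommRingCat.ofHom (Ideal.Quotient.mk (M))) =
      (affineBlowup.idealSheaf (M)).subschemeι := IsClosedImmersion.lift_fac _ _ _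
  haveI : IsIso σ := IsClosedImmersion.isIso_of_ker_eq _ _ σ hσ hker.symm
  -- `Spec (S/𝔪) → Spec S → Spec κ₀` is `Spec` of the bijection `κ₀ → S/𝔪`
  let e : CommRingCat.of κ₀ ≅ CommRingCat.of (S ⧸ M) :=
    (RingEquiv.ofBijective (algebraMap κ₀ (S ⧸ M)) hκ).toCommRingCatIso
  have hcomp : Spec.map (CommRingCat.ofHom (Ideal.Quotient.mk (M))) ≫
      Spec.map (CommRingCat.ofHom (algebraMap κ₀ S)) = Spec.map e.hom := by
    rw [← Spec.map_comp]
    congr 1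
  rw [← hσ, Category.assoc, hcomp]
  infer_instance

/-- **`i ≫ r₀ : E ⟶ ℙᵐ_{κ₀}` is an isomorphism** for `y` quasi-regular generating a maximal ideal and
`κ₀ → S/𝔪` bijective, `r₀ = (X₁ → ℙᵐ_S → ℙᵐ_{κ₀})`: `E = X₁ ×_{Spec S} V(𝔪~) = ℙᵐ_S ×_S V(𝔪~) =
ℙᵐ_{κ₀} ×_{κ₀} V(𝔪~)` and `V(𝔪~) ≅ Spec κ₀`. [cite: Hartshorne1977, II Thm. 8.24 (b)]
[cite: Liu2002, Prop. 3.1.9 and Ex. 3.1.10] -/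
theorem isIso_subschemeι_comp_retraction₀ (hqr : IsQuasiRegular y)
    (hκ : Function.Bijective (algebraMap κ₀ (S ⧸ M))) :
    letI : GradedRing (MvPolynomial.homogeneousSubmodule (Fin (m + 1)) S) := MvPolynomial.gradedAlgebra
    letI : GradedRing (MvPolynomial.homogeneousSubmodule (Fin (m + 1)) κ₀) := MvPolynomial.gradedAlgebra
    IsIso ((𝓔).subschemeι ≫ R₀) := by
  letI : GradedRing (MvPolynomial.homogeneousSubmodule (Fin (m + 1)) S) := MvPolynomial.gradedAlgebra
  letI : GradedRing (MvPolynomial.homogeneousSubmodule (Fin (m + 1)) κ₀) := MvPolynomial.gradedAlgebra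
  have hj : (affineBlowup.idealSheaf (M)).subschemeι.ker = affineBlowup.idealSheaf (M) :=
    Scheme.IdealSheafData.ker_subschemeι _
  -- `X₁ ×_S V(𝔪~) = ℙᵐ_S ×_S V(𝔪~)` pasted with `ℙᵐ_S = ℙᵐ_{κ₀} ×_{κ₀} Spec S`
  have H := (isPullback_exceptional_projectiveSpace y _ hj hqr).paste_horiz
    (isPullback_projMap' κ₀ S (n := m))
  haveI := isIso_subschemeι_comp_specMap_algebraMap y κ₀ hκ
  haveI hfst := H.isIso_fst_of_isIso
  have hf : (𝓔).subschemeι ≫ R₀ =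
      ((affineBlowup.idealSheaf (M)).comapIso (g)).hom ≫
        ((pullback.fst (g) (affineBlowup.idealSheaf (M)).subschemeι ≫
          Proj.map (reesPresentation y) (irrelevant_le_map_reesPresentation y)) ≫
          Proj.map (mapGraded κ₀ S (Fin (m + 1))) (irrelevant_le_map κ₀ S (Fin (m + 1)))) := by
    rw [Category.assoc, ← Category.assoc ((affineBlowup.idealSheaf (M)).comapIso (g)).hom,
      Scheme.IdealSheafData.comapIso_hom_fst]
  rw [hf]
  infer_instance

/-- **The retraction `r : X₁ ⟶ E` with `i ≫ r = 𝟙 E`** (`r := r₀ ≫ (i ≫ r₀)⁻¹`), together with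
`r ≫ (i ≫ r₀) = r₀`, so that pulling an ideal sheaf `𝔟` of `ℙᵐ_{κ₀}` back along `r₀` is pulling `𝔟|_E`
(along `i ≫ r₀`) back along `r`. [cite: GortzWedhorn2020, Def. 13.90] [cite: Hartshorne1977, II Thm. 8.24 (b)] -/
theorem exists_retraction (hqr : IsQuasiRegular y) (hκ : Function.Bijective (algebraMap κ₀ (S ⧸ M))) :
    letI : GradedRing (MvPolynomial.homogeneousSubmodule (Fin (m + 1)) S) := MvPolynomial.gradedAlgebra
    letI : GradedRing (MvPolynomial.homogeneousSubmodule (Fin (m + 1)) κ₀) := MvPolynomial.gradedAlgebra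
    ∃ r : X₁ ⟶ (𝓔).subscheme, (𝓔).subschemeι ≫ r = 𝟙 _ ∧ r ≫ ((𝓔).subschemeι ≫ R₀) = R₀ ∧
      ∀ 𝔟 : (ProjSpace.P m κ₀).IdealSheafData,
        𝔟.comap R₀ = (𝔟.comap ((𝓔).subschemeι ≫ R₀)).comap r := by
  letI : GradedRing (MvPolynomial.homogeneousSubmodule (Fin (m + 1)) S) := MvPolynomial.gradedAlgebra
  letI : GradedRing (MvPolynomial.homogeneousSubmodule (Fin (m + 1)) κ₀) := MvPolynomial.gradedAlgebra
  haveI := isIso_subschemeι_comp_retraction₀ y κ₀ hqr hκ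
  have h2 : (R₀ ≫ inv ((𝓔).subschemeι ≫ R₀)) ≫ ((𝓔).subschemeι ≫ R₀) = R₀ := by
    rw [Category.assoc, IsIso.inv_hom_id, Category.comp_id]
  refine ⟨R₀ ≫ inv ((𝓔).subschemeι ≫ R₀), ?_, h2, fun 𝔟 => ?_⟩
  · rw [← Category.assoc, IsIso.hom_inv_id]
  · rw [← Scheme.IdealSheafData.comap_comp, h2]

end Retraction

end DepthOne

end Summit.ResolutionOfSingularities.ResolutionOfSingularities.Theorems

end
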